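import Summits.HubbardSuperconductivity.HubbardSuperconductivity.Theorems.AnisotropyChordTransferFibre3TargetsV2

/-!
# Route `AnisotropyChord` / H0 rotor rung: PORT N30-A — the `T`-derivative of the Krein matrix and its sign

Towards `PhiAntitone` (memo ROTOR-THEORY-20 §279(b),(d): `3V²Φ'(T) = −⟨x, G_T² x⟩ ≤ 0`): the entries of the pole-removed
resolvent kernel `G_T` and of the Krein matrix `𝒩(T)` are rational in `T`; for `T < 2ε₁` (`L ≥ 4`, all denominators
positive, `den_pos`) they are differentiable with derivative the kernel `G2entry` (`= V⁻² Σ' e^{ik·(c−c')}/den²`,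
`hasDerivAt_Gentry`, `hasDerivAt_Nmat`), whose quadratic form on `D ⊕ S` is positive semidefinite (`re_G2form_nonneg`);
and `𝒩(T)` is Hermitian (`Nmat_conjTranspose`).
Prover seat `hubbard-h0-rotor-p1` g21; helper for stmt-HubbardSuperconductivity-19089 (`--supports`).
-/

set_option linter.dupNamespace false
set_option autoImplicit false

noncomputable section

open scoped BigOperators
open Complex Matrix

namespace Summit.HubbardSuperconductivity.HubbardSuperconductivity.Theorems.AnisotropyChord.Transfer.Fibre3

variable (L : ℕ) [NeZero L]

/-- derivative of one resolvent term `A/(B − t)`. [folklore] -/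
theorem hasDerivAt_const_div (A : ℂ) (B T : ℝ) (h : B - T ≠ 0) :
    HasDerivAt (fun t : ℝ => A / (((B - t : ℝ)) : ℂ)) (A / (((B - T : ℝ) : ℂ)) ^ 2) T := by
  have hz : ((B : ℂ) - (T : ℂ)) ≠ 0 := by
    rw [← Complex.ofReal_sub]; exact_mod_cast h
  have h1 : HasDerivAt (fun z : ℂ => (B : ℂ) - z) (-1) (T : ℂ) := (hasDerivAt_id (T : ℂ)).const_sub (B : ℂ)
  have h2 : HasDerivAt (fun z : ℂ => A * ((B : ℂ) - z)⁻¹) (A * (-(-1) / ((B : ℂ) - T) ^ 2)) (T : ℂ) :=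
    (h1.inv hz).const_mul A
  have h3 : HasDerivAt (fun t : ℝ => A * ((B : ℂ) - (t : ℂ))⁻¹) (A * (-(-1) / ((B : ℂ) - T) ^ 2)) T :=
    h2.comp_ofReal
  have e : (fun t : ℝ => A / (((B - t : ℝ)) : ℂ)) = fun t : ℝ => A * ((B : ℂ) - (t : ℂ))⁻¹ := by
    funext t; rw [div_eq_mul_inv]; push_cast; ring
  rw [e]
  refine h3.congr_deriv ?_
  push_cast; field_simp

/-- the `T`-derivative kernel `G_T² = V⁻² Σ' e^{ik·(c − c')}/den²`. [folklore] -/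
def G2entry (T : ℝ) (c c' : Cfg L) : ℂ :=
  (1 / ((L : ℂ) ^ 2) ^ 2) * ∑ k : Tor L × Tor L,
    (if IsPoleK1 L k.1 k.2 then 0 else pw L k.1 k.2 c * (starRingEnd ℂ) (pw L k.1 k.2 c') / (den L T k.1 k.2 : ℂ) ^ 2)

/-- **`∂_T G_T(c,c') = G_T²(c,c')`** for `T < 2ε₁` (`L ≥ 4`). [folklore] -/
theorem hasDerivAt_Gentry (hL : 4 ≤ L) {T : ℝ} (hT : T < 2 * eps1 L) (c c' : Cfg L) :
    HasDerivAt (fun t : ℝ => Gentry L t c c') (G2entry L T c c') T := by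
  have e : (fun t : ℝ => Gentry L t c c') = fun t : ℝ => (1 / ((L : ℂ) ^ 2) ^ 2) * ∑ k : Tor L × Tor L,
      (if IsPoleK1 L k.1 k.2 then 0 else pw L k.1 k.2 c * (starRingEnd ℂ) (pw L k.1 k.2 c') / (den L t k.1 k.2 : ℂ)) := by
    funext t; rw [Gentry_eq]
  rw [e]
  unfold G2entry
  apply HasDerivAt.const_mul
  apply HasDerivAt.fun_sum
  intro k _
  by_cases hk : IsPoleK1 L k.1 k.2 = true
  · simp only [hk, if_true]; exact hasDerivAt_const T (0 : ℂ)
  · have hk' : IsPoleK1 L k.1 k.2 = false := by simpa using hk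
    simp only [hk', Bool.false_eq_true, if_false]
    have hd : efree L k - eps1 L - T ≠ 0 := by
      have := den_pos L hL hT hk'; rw [den_eq] at this; exact ne_of_gt this
    exact hasDerivAt_const_div (pw L k.1 k.2 c * (starRingEnd ℂ) (pw L k.1 k.2 c')) (efree L k - eps1 L) T hd

/-- **`∂_T 𝒩(T)_{ij} = G_T²(c_i, c_j)`** (the contact block is `T`-independent). [folklore] -/
theorem hasDerivAt_Nmat (hL : 4 ≤ L) {T : ℝ} (hT : T < 2 * eps1 L) (Δ : ℝ) (i j : DS L) :
    HasDerivAt (fun t : ℝ => Nmat L t Δ i j) (G2entry L T (cfgOf L i) (cfgOf L j)) T := by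
  unfold Nmat
  exact (hasDerivAt_Gentry L hL hT (cfgOf L i) (cfgOf L j)).sub_const _

/-- `G_T` is Hermitian: `conj G_T(c', c) = G_T(c, c')`. [folklore] -/
theorem conj_Gentry (T : ℝ) (c c' : Cfg L) : (starRingEnd ℂ) (Gentry L T c' c) = Gentry L T c c' := by
  rw [Gentry_eq, Gentry_eq, map_mul, map_sum]
  congr 1
  · rw [map_div₀, map_one, map_pow, map_pow, Complex.conj_natCast]
  · refine Finset.sum_congr rfl fun k _ => ?_
    split_ifs
    · simp
    · rw [map_div₀, Complex.conj_ofReal, map_mul, Complex.conj_conj]; ring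

/-- **`𝒩(T)` is Hermitian.** [folklore] -/
theorem Nmat_conjTranspose (T Δ : ℝ) : (Nmat L T Δ)ᴴ = Nmat L T Δ := by
  ext i j
  rw [conjTranspose_apply, star_def]
  unfold Nmat
  rw [map_sub, conj_Gentry]
  congr 1
  rcases i with d | s <;> rcases j with d' | s'
  · simp
  · simp
  · simp
  · simp only
    by_cases h : s = s'
    · subst h; simp [Complex.conj_ofReal]
    · have h' : ¬ s' = s := fun e => h e.symm
      simp [h, h']

/-- the derivative matrix on `D ⊕ S`. [folklore] -/
def G2mat (T : ℝ) : Matrix (DS L) (DS L) ℂ := fun i j => G2entry L T (cfgOf L i) (cfgOf L j)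

/-- the (real, nonnegative) mode weights `1/den²` off the poles. [folklore] -/
def wk (T : ℝ) (k : Tor L × Tor L) : ℝ := if IsPoleK1 L k.1 k.2 then 0 else 1 / (den L T k.1 k.2) ^ 2

omit [NeZero L] in
/-- [folklore] -/
theorem wk_nonneg (T : ℝ) (k : Tor L × Tor L) : 0 ≤ wk L T k := by
  unfold wk; split_ifs
  · exact le_rfl
  · positivity

/-- `G_T²` as a weighted sum of rank-one plane-wave kernels. [folklore] -/
theorem G2entry_eq (T : ℝ) (c c' : Cfg L) :
    G2entry L T c c' = (1 / ((L : ℂ) ^ 2) ^ 2) * ∑ k : Tor L × Tor L,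
      (wk L T k : ℂ) * (pw L k.1 k.2 c * (starRingEnd ℂ) (pw L k.1 k.2 c')) := by
  unfold G2entry wk
  congr 1
  refine Finset.sum_congr rfl fun k _ => ?_
  split_ifs
  · simp
  · push_cast; ring

/-- the mode amplitudes `Z_k(y) = Σ_j conj(pw_k(c_j)) y_j`. [folklore] -/
def Zk (y : DS L → ℂ) (k : Tor L × Tor L) : ℂ := ∑ j : DS L, (starRingEnd ℂ) (pw L k.1 k.2 (cfgOf L j)) * y j

/-- `(G_T² y)_i = V⁻² Σ_k w_k pw_k(c_i) Z_k(y)`. [folklore] -/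
theorem G2_mulVec (T : ℝ) (y : DS L → ℂ) (i : DS L) :
    (G2mat L T).mulVec y i
      = (1 / ((L : ℂ) ^ 2) ^ 2) * ∑ k : Tor L × Tor L, (wk L T k : ℂ) * (pw L k.1 k.2 (cfgOf L i) * Zk L y k) := by
  simp only [Matrix.mulVec, dotProduct]
  unfold G2mat
  simp_rw [G2entry_eq]
  unfold Zk
  calc ∑ j : DS L, ((1 / ((L : ℂ) ^ 2) ^ 2) * ∑ k : Tor L × Tor L,
          (wk L T k : ℂ) * (pw L k.1 k.2 (cfgOf L i) * (starRingEnd ℂ) (pw L k.1 k.2 (cfgOf L j)))) * y j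
      = ∑ j : DS L, ∑ k : Tor L × Tor L, (1 / ((L : ℂ) ^ 2) ^ 2) *
          ((wk L T k : ℂ) * (pw L k.1 k.2 (cfgOf L i) * ((starRingEnd ℂ) (pw L k.1 k.2 (cfgOf L j)) * y j))) := by
        refine Finset.sum_congr rfl fun j _ => ?_
        rw [Finset.mul_sum, Finset.sum_mul]
        refine Finset.sum_congr rfl fun k _ => ?_
        ring
    _ = ∑ k : Tor L × Tor L, ∑ j : DS L, (1 / ((L : ℂ) ^ 2) ^ 2) *
          ((wk L T k : ℂ) * (pw L k.1 k.2 (cfgOf L i) * ((starRingEnd ℂ) (pw L k.1 k.2 (cfgOf L j)) * y j))) :=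
        Finset.sum_comm
    _ = (1 / ((L : ℂ) ^ 2) ^ 2) * ∑ k : Tor L × Tor L, (wk L T k : ℂ) * (pw L k.1 k.2 (cfgOf L i)
          * ∑ j : DS L, (starRingEnd ℂ) (pw L k.1 k.2 (cfgOf L j)) * y j) := by
        rw [Finset.mul_sum]
        refine Finset.sum_congr rfl fun k _ => ?_
        rw [Finset.mul_sum, Finset.mul_sum, Finset.mul_sum]

/-- **the quadratic form of `G_T²`:** `⟨y, G_T² y⟩ = V⁻² Σ_k w_k |Z_k(y)|²`. [folklore] -/
theorem G2_form (T : ℝ) (y : DS L → ℂ) :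
    star y ⬝ᵥ (G2mat L T).mulVec y
      = (1 / ((L : ℂ) ^ 2) ^ 2) * ∑ k : Tor L × Tor L, (wk L T k : ℂ) * ((starRingEnd ℂ) (Zk L y k) * Zk L y k) := by
  simp only [dotProduct, Pi.star_apply, star_def]
  simp_rw [G2_mulVec]
  have hconj : ∀ k : Tor L × Tor L,
      (starRingEnd ℂ) (Zk L y k) = ∑ i : DS L, (starRingEnd ℂ) (y i) * pw L k.1 k.2 (cfgOf L i) := by
    intro k; unfold Zk; rw [map_sum]
    refine Finset.sum_congr rfl fun i _ => ?_
    rw [map_mul, Complex.conj_conj]; ring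
  calc ∑ i : DS L, (starRingEnd ℂ) (y i) * ((1 / ((L : ℂ) ^ 2) ^ 2) * ∑ k : Tor L × Tor L,
          (wk L T k : ℂ) * (pw L k.1 k.2 (cfgOf L i) * Zk L y k))
      = ∑ i : DS L, ∑ k : Tor L × Tor L, (1 / ((L : ℂ) ^ 2) ^ 2) *
          ((wk L T k : ℂ) * (((starRingEnd ℂ) (y i) * pw L k.1 k.2 (cfgOf L i)) * Zk L y k)) := by
        refine Finset.sum_congr rfl fun i _ => ?_
        rw [Finset.mul_sum, Finset.mul_sum]
        refine Finset.sum_congr rfl fun k _ => ?_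
        ring
    _ = ∑ k : Tor L × Tor L, ∑ i : DS L, (1 / ((L : ℂ) ^ 2) ^ 2) *
          ((wk L T k : ℂ) * (((starRingEnd ℂ) (y i) * pw L k.1 k.2 (cfgOf L i)) * Zk L y k)) := Finset.sum_comm
    _ = (1 / ((L : ℂ) ^ 2) ^ 2) * ∑ k : Tor L × Tor L, (wk L T k : ℂ) * ((starRingEnd ℂ) (Zk L y k) * Zk L y k) := by
        rw [Finset.mul_sum]
        refine Finset.sum_congr rfl fun k _ => ?_
        rw [hconj k, Finset.sum_mul, Finset.mul_sum, Finset.mul_sum]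

/-- **`G_T² ≥ 0` on `D ⊕ S`:** `Re⟨y, G_T² y⟩ = V⁻² Σ_k w_k |Z_k(y)|² ≥ 0`. [folklore] -/
theorem re_G2form_nonneg (T : ℝ) (y : DS L → ℂ) : 0 ≤ (star y ⬝ᵥ (G2mat L T).mulVec y).re := by
  rw [G2_form]
  have hV : (1 / ((L : ℂ) ^ 2) ^ 2) = (((1 / ((L : ℝ) ^ 2) ^ 2 : ℝ)) : ℂ) := by push_cast; ring
  rw [hV, Complex.re_ofReal_mul]
  apply mul_nonneg (by positivity)
  rw [Complex.re_sum]
  apply Finset.sum_nonneg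
  intro k _
  rw [Complex.re_ofReal_mul, Complex.conj_mul', show ((‖Zk L y k‖ : ℂ) ^ 2) = (((‖Zk L y k‖ ^ 2 : ℝ)) : ℂ) by push_cast; ring,
    Complex.ofReal_re]
  exact mul_nonneg (wk_nonneg L T k) (sq_nonneg _)

end Summit.HubbardSuperconductivity.HubbardSuperconductivity.Theorems.AnisotropyChord.Transfer.Fibre3

end
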